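import Literature.Geometry.Kaehler.ComplexTorusHodgeGroupProductDerivedSeries
import HarnessLib

/-!
# `Hg(X₁ × X₂)` is semisimple iff `Hg(X₁)` and `Hg(X₂)` are: the radical of `Hg(X₁ × X₂)(ℂ)` projects into the radicals
# of the factors (every pair of complex tori), so `R(Hg(X₁)) = R(Hg(X₂)) = 1 ⟹ R(Hg(X₁ × X₂)) = 1`; for polarised tori
# the converse (g37-#6) closes the iff, in radical and in perfect form

Layer `Literature/Geometry/Kaehler`, namespace `Literature.Geometry.Kaehler.ComplexTorus`; lane `lit-hodgefound`
(Track 2 foundations library), Layer A3; prover seat `lit-hodgefound-p17` (generation 37, self-proposed row g37-#7, sequel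
of g37-#1 `ComplexTorusHodgeGroupProductProjectionsSurjective` (the block projections `prᵢ : Hg(X₁ × X₂)(ℂ) →
Hg(Xᵢ)(ℂ)` are ALGEBRAIC and ONTO) and g37-#6 `ComplexTorusHodgeGroupProductDerivedSeries` (`Hg(X₁ × X₂)(ℂ)` perfect ⟹
factors perfect)). THEOREMS ONLY (no definition, no instance, no notation, no named fact; D-0026 net debt 0).
Consumed BY NAME: the linear-algebraic-groups library's radical `R(G) = radical G` (`le_radical` = maximality among
Zariski-connected solvable normal subgroups, `isZConnected_radical`, `isSolvable_radical`, `normal_radical`,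
`radical_le`), Springer 2.2.5 for algebraic homomorphisms (`MonoidHom.IsAlgebraicGL.isZConnected_map_of_le`), the block
projections `fstBlockGL`/`sndBlockGL` (`isAlgebraicGL_fstBlockGL_comp`, `blockDiagGL_fstBlockGL_sndBlockGL`), g37-#1's
`range_fstBlockGL_comp_inclusion_hodgeGroupC` + `hodgeGroupCProdFst_eq_hodgeGroupC`, and p22's "semisimple ⟺ perfect"
`IsRiemannForm.radical_map_toGL_hodgeGroupC_eq_bot_iff_commutator_eq`.

## Sources, verbatim

* B. Moonen, Yu. G. Zarhin [MoonenZarhin1999LowDim], held `paper:arxiv-math_9901113`, §3 (3.1) (p0006 L25–L28):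
  "`Hg(X₁ × X₂)` is an algebraic subgroup of `Hg(X₁) × Hg(X₂)`; the two projections are surjective"; §1: "If `X`
  has no factors of Type IV then `Hg(X)` is semi-simple".
* B. B. Gordon [Gordon1997], held `paper:arxiv-alg-geom_9709030`, §1 Definition 1.3 ("semisimple"), §2.5.2 Corollary,
  §2.9 Proposition ("If `X` has no factors of Type 4 then `Hg(X)` is semi-simple"), §2.16 Proposition (Goursat),
  §3 Theorem, proof (p0014 L33–L37).
* T. A. Springer, *Linear Algebraic Groups*, 2nd ed. (1998) [Springer1998], 2.2.5 (ii), (iv) (images of closed ∕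
  connected groups under morphisms), 6.4.14 (the radical), 7.3.1, 8.1.5 (ii) (semisimple ⟺ `G = (G, G)`).

The argument (standard, e.g. the proof that a product ∕ an image of semisimple groups is semisimple): `R =
R(Hg(X₁ × X₂)(ℂ))` is Zariski-connected, solvable and normal; its image `pr₁(R)` under the algebraic surjection
`pr₁ : Hg(X₁ × X₂)(ℂ) ↠ Hg(X₁)(ℂ)` is Zariski-connected (2.2.5), solvable and normal in `Hg(X₁)(ℂ)`, hence lies in
`R(Hg(X₁)(ℂ))` (6.4.14); so `R(Hg(Xᵢ)) = 1` for both `i` forces both blocks of every element of `R` to be `1`.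

## What is proved

* §1 (every pair of complex tori) **`map_fstBlockGL_radical_le_radical`** ∕ **`map_sndBlockGL_radical_le_radical`**:
  `prᵢ(R(Hg(X₁ × X₂)(ℂ))) ≤ R(Hg(Xᵢ)(ℂ))`; **`radical_map_toGL_hodgeGroupC_prod_eq_bot`**: `R(Hg(X₁)(ℂ)) = 1` and
  `R(Hg(X₂)(ℂ)) = 1` ⟹ `R(Hg(X₁ × X₂)(ℂ)) = 1`.
* §2 (polarised tori) **`IsRiemannForm.radical_map_toGL_hodgeGroupC_prod_eq_bot_iff`** (`Hg(X₁ × X₂)` semisimple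
  ⟺ `Hg(X₁)`, `Hg(X₂)` semisimple), **`IsRiemannForm.commutator_hodgeGroupC_prod_eq_self_iff`** (perfect form:
  `(Hg(X₁ × X₂), Hg(X₁ × X₂)) = Hg(X₁ × X₂) ⟺` both factors perfect), `IsRiemannForm.commutator_hodgeGroupC_prod_eq_self`,
  and the arithmetic inputs `IsRiemannForm.commutator_hodgeGroupC_prod_eq_self_of_forall_rosati_eq` (both factors with
  Rosati-fixed centre of `End_ℚ` — "no factors of Type IV") ∕ `…_of_endAlgRat_eq_bot` (`End_ℚ(Xᵢ) = ℚ`).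
* §3 THREE FACTORS: `IsRiemannForm.hodgeGroupC_prod_prod_eq_blockDiagProd_of_commutator_eq` — `Hg((X₁ × X₂) × Y)(ℂ) =
  Hg(X₁ × X₂)(ℂ) × Hg(Y)(ℂ)` for polarised `X₁`, `X₂` with perfect Hodge groups and `Y` with commutative `Hg(Y)(ℂ)`
  (g37-#2's Gordon lemma with the now-available perfectness of `Hg(X₁ × X₂)(ℂ)`), its real points, and the
  stable-nondegeneracy form `IsRiemannForm.forall_divisorClasses_powPeriod_prod_prod_eq_hodgeClasses_of_commutator_eq`
  (`X₁ × X₂` and `Y` stably nondegenerate ⟹ `(X₁ × X₂) × Y` stably nondegenerate).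

NOT here: splitting of `Hg(X₁ × X₂)` itself for two semisimple factors (Gordon 7.6.2 proper; needs the Lie-algebra
form of Goursat's lemma).

## References

* [MoonenZarhin1999LowDim] B. Moonen, Yu. G. Zarhin, Math. Ann. 315 (1999), §3 (3.1), §1.
* [Gordon1997] B. B. Gordon, *A survey of the Hodge conjecture for abelian varieties* (alg-geom/9709030), §1 Def. 1.3,
  §2.5.2, §2.9, §2.16, §3 Theorem.
* [Springer1998] T. A. Springer, *Linear Algebraic Groups*, 2nd ed. (1998), 2.2.5, 6.4.14, 7.3.1, 8.1.5.
-/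

noncomputable section

open Matrix Module
open scoped MatrixGroups

namespace Literature.Geometry.Kaehler

namespace ComplexTorus

open Literature.NumberTheory.Automorphic

variable {ι₁ ι₂ : Type*} [Fintype ι₁] [Fintype ι₂] [DecidableEq ι₁] [DecidableEq ι₂]
  {E₁ E₂ : Type*} [NormedAddCommGroup E₁] [NormedSpace ℂ E₁] [NormedAddCommGroup E₂] [NormedSpace ℂ E₂]
  (Φ₁ : (ι₁ → ℝ) ≃L[ℝ] E₁) (Φ₂ : (ι₂ → ℝ) ≃L[ℝ] E₂)

/-! ## §1 The radical of `Hg(X₁ × X₂)(ℂ)` projects into the radicals of the factors -/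

section Radical

/-- **`pr₁(R(Hg(X₁ × X₂)(ℂ))) ≤ R(Hg(X₁)(ℂ))`**: the image of the radical under the algebraic surjection `pr₁ :
Hg(X₁ × X₂)(ℂ) ↠ Hg(X₁)(ℂ)` is Zariski-connected (Springer 2.2.5), solvable and normal in `Hg(X₁)(ℂ)`, hence inside the
radical (6.4.14). Every pair of complex tori. [cite: Springer1998, 2.2.5 (ii), (iv) and 6.4.14]
[cite: MoonenZarhin1999LowDim, §3 (3.1)] -/
theorem map_fstBlockGL_radical_le_radical :
    (((radical ((hodgeGroupC (prodPeriod Φ₁ Φ₂)).map Matrix.SpecialLinearGroup.toGL)).subgroupOf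
        ((hodgeGroupC (prodPeriod Φ₁ Φ₂)).map Matrix.SpecialLinearGroup.toGL)).map
      (fstBlockGL.comp (Subgroup.inclusion (map_toGL_hodgeGroupC_prod_le_blockDiagRange Φ₁ Φ₂)))) ≤
      radical ((hodgeGroupC Φ₁).map Matrix.SpecialLinearGroup.toGL) := by
  set G := (hodgeGroupC (prodPeriod Φ₁ Φ₂)).map Matrix.SpecialLinearGroup.toGL with hG
  set f := fstBlockGL.comp (Subgroup.inclusion (map_toGL_hodgeGroupC_prod_le_blockDiagRange Φ₁ Φ₂)) with hf
  have hrange : f.range = (hodgeGroupC Φ₁).map Matrix.SpecialLinearGroup.toGL := by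
    rw [hf, range_fstBlockGL_comp_inclusion_hodgeGroupC, hodgeGroupCProdFst_eq_hodgeGroupC]
  have hle : ((radical G).subgroupOf G).map f ≤ (hodgeGroupC Φ₁).map Matrix.SpecialLinearGroup.toGL := by
    rw [← hrange]
    exact Subgroup.map_le_range f _
  have hconn : IsZConnected (((radical G).subgroupOf G).map f) :=
    (isAlgebraicGL_fstBlockGL_comp _).isZConnected_map_of_le (isZConnected_radical G) (radical_le G)
  have hsolvR : IsSolvable ↥((radical G).subgroupOf G) := by
    haveI := isSolvable_radical G
    exact solvable_of_solvable_injective (f := (Subgroup.subgroupOfEquivOfLe (radical_le G)).toMonoidHom)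
      (MulEquiv.injective _)
  have hsolv : IsSolvable ↥(((radical G).subgroupOf G).map f) := by
    haveI := hsolvR
    exact solvable_of_surjective (MonoidHom.subgroupMap_surjective f _)
  have hnormal : ((((radical G).subgroupOf G).map f).subgroupOf
      ((hodgeGroupC Φ₁).map Matrix.SpecialLinearGroup.toGL)).Normal := by
    refine ⟨fun x hx y ↦ ?_⟩
    rw [Subgroup.mem_subgroupOf] at hx ⊢
    obtain ⟨r, hr, hxr⟩ := hx
    have hy : (y : GL ι₁ ℂ) ∈ f.range := by
      rw [hrange]
      exact y.2
    obtain ⟨g, hg⟩ := hy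
    refine ⟨g * r * g⁻¹, (normal_radical G).conj_mem r hr g, ?_⟩
    rw [map_mul, map_mul, map_inv, hxr, hg, Subgroup.coe_mul, Subgroup.coe_mul, Subgroup.coe_inv]
  exact le_radical hle hnormal hconn hsolv

/-- **`pr₂(R(Hg(X₁ × X₂)(ℂ))) ≤ R(Hg(X₂)(ℂ))`.** [cite: Springer1998, 2.2.5 (ii), (iv) and 6.4.14] [cite: MoonenZarhin1999LowDim, §3 (3.1)] -/
theorem map_sndBlockGL_radical_le_radical :
    (((radical ((hodgeGroupC (prodPeriod Φ₁ Φ₂)).map Matrix.SpecialLinearGroup.toGL)).subgroupOf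
        ((hodgeGroupC (prodPeriod Φ₁ Φ₂)).map Matrix.SpecialLinearGroup.toGL)).map
      (sndBlockGL.comp (Subgroup.inclusion (map_toGL_hodgeGroupC_prod_le_blockDiagRange Φ₁ Φ₂)))) ≤
      radical ((hodgeGroupC Φ₂).map Matrix.SpecialLinearGroup.toGL) := by
  set G := (hodgeGroupC (prodPeriod Φ₁ Φ₂)).map Matrix.SpecialLinearGroup.toGL with hG
  set f := sndBlockGL.comp (Subgroup.inclusion (map_toGL_hodgeGroupC_prod_le_blockDiagRange Φ₁ Φ₂)) with hf
  have hrange : f.range = (hodgeGroupC Φ₂).map Matrix.SpecialLinearGroup.toGL := by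
    rw [hf, range_sndBlockGL_comp_inclusion_hodgeGroupC, hodgeGroupCProdSnd_eq_hodgeGroupC]
  have hle : ((radical G).subgroupOf G).map f ≤ (hodgeGroupC Φ₂).map Matrix.SpecialLinearGroup.toGL := by
    rw [← hrange]
    exact Subgroup.map_le_range f _
  have hconn : IsZConnected (((radical G).subgroupOf G).map f) :=
    (isAlgebraicGL_sndBlockGL_comp _).isZConnected_map_of_le (isZConnected_radical G) (radical_le G)
  have hsolvR : IsSolvable ↥((radical G).subgroupOf G) := by
    haveI := isSolvable_radical G
    exact solvable_of_solvable_injective (f := (Subgroup.subgroupOfEquivOfLe (radical_le G)).toMonoidHom)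
      (MulEquiv.injective _)
  have hsolv : IsSolvable ↥(((radical G).subgroupOf G).map f) := by
    haveI := hsolvR
    exact solvable_of_surjective (MonoidHom.subgroupMap_surjective f _)
  have hnormal : ((((radical G).subgroupOf G).map f).subgroupOf
      ((hodgeGroupC Φ₂).map Matrix.SpecialLinearGroup.toGL)).Normal := by
    refine ⟨fun x hx y ↦ ?_⟩
    rw [Subgroup.mem_subgroupOf] at hx ⊢
    obtain ⟨r, hr, hxr⟩ := hx
    have hy : (y : GL ι₂ ℂ) ∈ f.range := by
      rw [hrange]
      exact y.2
    obtain ⟨g, hg⟩ := hy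
    refine ⟨g * r * g⁻¹, (normal_radical G).conj_mem r hr g, ?_⟩
    rw [map_mul, map_mul, map_inv, hxr, hg, Subgroup.coe_mul, Subgroup.coe_mul, Subgroup.coe_inv]
  exact le_radical hle hnormal hconn hsolv

/-- **`R(Hg(X₁)(ℂ)) = 1` and `R(Hg(X₂)(ℂ)) = 1 ⟹ R(Hg(X₁ × X₂)(ℂ)) = 1`** — every pair of complex tori: both blocks of
an element of the radical lie in the radicals of the factors. [cite: Springer1998, 2.2.5 and 6.4.14]
[cite: MoonenZarhin1999LowDim, §3 (3.1) and §1] [cite: Gordon1997, §2.9 Proposition] -/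
theorem radical_map_toGL_hodgeGroupC_prod_eq_bot
    (h₁ : radical ((hodgeGroupC Φ₁).map Matrix.SpecialLinearGroup.toGL) = ⊥)
    (h₂ : radical ((hodgeGroupC Φ₂).map Matrix.SpecialLinearGroup.toGL) = ⊥) :
    radical ((hodgeGroupC (prodPeriod Φ₁ Φ₂)).map Matrix.SpecialLinearGroup.toGL) = ⊥ := by
  set G := (hodgeGroupC (prodPeriod Φ₁ Φ₂)).map Matrix.SpecialLinearGroup.toGL with hG
  refine (Subgroup.eq_bot_iff_forall _).2 fun x hx ↦ ?_
  have hxG : x ∈ G := radical_le G hx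
  have hg : (⟨x, hxG⟩ : ↥G) ∈ (radical G).subgroupOf G := by
    rw [Subgroup.mem_subgroupOf]
    exact hx
  have e₁ : fstBlockGL (Subgroup.inclusion (map_toGL_hodgeGroupC_prod_le_blockDiagRange Φ₁ Φ₂) ⟨x, hxG⟩) = 1 := by
    have h := map_fstBlockGL_radical_le_radical Φ₁ Φ₂ ⟨⟨x, hxG⟩, hg, rfl⟩
    rwa [h₁, Subgroup.mem_bot, MonoidHom.comp_apply] at h
  have e₂ : sndBlockGL (Subgroup.inclusion (map_toGL_hodgeGroupC_prod_le_blockDiagRange Φ₁ Φ₂) ⟨x, hxG⟩) = 1 := by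
    have h := map_sndBlockGL_radical_le_radical Φ₁ Φ₂ ⟨⟨x, hxG⟩, hg, rfl⟩
    rwa [h₂, Subgroup.mem_bot, MonoidHom.comp_apply] at h
  have key := blockDiagGL_fstBlockGL_sndBlockGL
    (Subgroup.inclusion (map_toGL_hodgeGroupC_prod_le_blockDiagRange Φ₁ Φ₂) ⟨x, hxG⟩)
  rw [e₁, e₂, show ((1 : GL ι₁ ℂ), (1 : GL ι₂ ℂ)) = 1 from rfl, map_one] at key
  exact key.symm

end Radical

/-! ## §2 Polarised tori: `Hg(X₁ × X₂)` semisimple iff `Hg(X₁)`, `Hg(X₂)` semisimple -/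

section Polarised

variable {Φ₁ Φ₂} {η₁ : E₁ [⋀^Fin 2]→L[ℝ] ℝ} {η₂ : E₂ [⋀^Fin 2]→L[ℝ] ℝ}

/-- **`Hg(X₁ × X₂)` IS SEMISIMPLE IFF `Hg(X₁)` AND `Hg(X₂)` ARE** (polarised complex tori; radical form `R = 1`).
⟸ §1 (all tori); ⟹ g37-#6 (the derived group projects onto the derived groups; semisimple ⟺ perfect for the connected
reductive Hodge groups). [cite: MoonenZarhin1999LowDim, §1 and §3 (3.1)] [cite: Gordon1997, §2.9 Proposition and §2.5.2 Corollary]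
[cite: Springer1998, 6.4.14 and 8.1.5 (ii)] -/
theorem IsRiemannForm.radical_map_toGL_hodgeGroupC_prod_eq_bot_iff (hη₁ : IsRiemannForm Φ₁ η₁)
    (hη₂ : IsRiemannForm Φ₂ η₂) :
    radical ((hodgeGroupC (prodPeriod Φ₁ Φ₂)).map Matrix.SpecialLinearGroup.toGL) = ⊥ ↔
      radical ((hodgeGroupC Φ₁).map Matrix.SpecialLinearGroup.toGL) = ⊥ ∧
        radical ((hodgeGroupC Φ₂).map Matrix.SpecialLinearGroup.toGL) = ⊥ :=
  ⟨hη₁.radical_map_toGL_hodgeGroupC_eq_bot_of_prod hη₂, fun h ↦ radical_map_toGL_hodgeGroupC_prod_eq_bot Φ₁ Φ₂ h.1 h.2⟩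

/-- **Perfect form: `(Hg(X₁ × X₂)(ℂ), Hg(X₁ × X₂)(ℂ)) = Hg(X₁ × X₂)(ℂ)` iff `Hg(X₁)(ℂ)` and `Hg(X₂)(ℂ)` are perfect**
(polarised tori). [cite: Springer1998, 8.1.5 (ii)] [cite: Gordon1997, §2.5.2 Corollary and §2.9 Proposition]
[cite: MoonenZarhin1999LowDim, §1 and §3 (3.1)] -/
theorem IsRiemannForm.commutator_hodgeGroupC_prod_eq_self_iff (hη₁ : IsRiemannForm Φ₁ η₁)
    (hη₂ : IsRiemannForm Φ₂ η₂) :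
    ⁅hodgeGroupC (prodPeriod Φ₁ Φ₂), hodgeGroupC (prodPeriod Φ₁ Φ₂)⁆ = hodgeGroupC (prodPeriod Φ₁ Φ₂) ↔
      ⁅hodgeGroupC Φ₁, hodgeGroupC Φ₁⁆ = hodgeGroupC Φ₁ ∧ ⁅hodgeGroupC Φ₂, hodgeGroupC Φ₂⁆ = hodgeGroupC Φ₂ := by
  rw [← (hη₁.prod hη₂).radical_map_toGL_hodgeGroupC_eq_bot_iff_commutator_eq,
    ← hη₁.radical_map_toGL_hodgeGroupC_eq_bot_iff_commutator_eq,
    ← hη₂.radical_map_toGL_hodgeGroupC_eq_bot_iff_commutator_eq]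
  exact hη₁.radical_map_toGL_hodgeGroupC_prod_eq_bot_iff hη₂

/-- **`Hg(X₁)(ℂ)`, `Hg(X₂)(ℂ)` perfect ⟹ `Hg(X₁ × X₂)(ℂ)` perfect** (polarised tori).
[cite: Gordon1997, §2.9 Proposition and §2.5.2 Corollary] [cite: MoonenZarhin1999LowDim, §1] -/
theorem IsRiemannForm.commutator_hodgeGroupC_prod_eq_self (hη₁ : IsRiemannForm Φ₁ η₁)
    (hη₂ : IsRiemannForm Φ₂ η₂) (h₁ : ⁅hodgeGroupC Φ₁, hodgeGroupC Φ₁⁆ = hodgeGroupC Φ₁)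
    (h₂ : ⁅hodgeGroupC Φ₂, hodgeGroupC Φ₂⁆ = hodgeGroupC Φ₂) :
    ⁅hodgeGroupC (prodPeriod Φ₁ Φ₂), hodgeGroupC (prodPeriod Φ₁ Φ₂)⁆ = hodgeGroupC (prodPeriod Φ₁ Φ₂) :=
  (hη₁.commutator_hodgeGroupC_prod_eq_self_iff hη₂).2 ⟨h₁, h₂⟩

/-- **"No factors of Type IV" for both factors ⟹ `Hg(X₁ × X₂)(ℂ)` perfect**: `X₁`, `X₂` polarised with Rosati-fixed
centres of `End_ℚ(Xᵢ)` (p22's `IsRiemannForm.commutator_hodgeGroupC_eq_self_of_forall_rosati_eq` per factor).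
[cite: MoonenZarhin1999LowDim, §1 ("If `X` has no factors of Type IV then `Hg(X)` is semi-simple")] [cite: Gordon1997, §2.9 Proposition] -/
theorem IsRiemannForm.commutator_hodgeGroupC_prod_eq_self_of_forall_rosati_eq (hη₁ : IsRiemannForm Φ₁ η₁)
    (hη₂ : IsRiemannForm Φ₂ η₂) {G₁ : Matrix ι₁ ι₁ ℚ} (hG₁ : G₁.map (Rat.cast : ℚ → ℝ) = latticeGram Φ₁ η₁)
    (htriv₁ : ∀ B ∈ endAlgRat Φ₁, (∀ C ∈ endAlgRat Φ₁, B * C = C * B) → rosati G₁ B = B)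
    {G₂ : Matrix ι₂ ι₂ ℚ} (hG₂ : G₂.map (Rat.cast : ℚ → ℝ) = latticeGram Φ₂ η₂)
    (htriv₂ : ∀ B ∈ endAlgRat Φ₂, (∀ C ∈ endAlgRat Φ₂, B * C = C * B) → rosati G₂ B = B) :
    ⁅hodgeGroupC (prodPeriod Φ₁ Φ₂), hodgeGroupC (prodPeriod Φ₁ Φ₂)⁆ = hodgeGroupC (prodPeriod Φ₁ Φ₂) :=
  hη₁.commutator_hodgeGroupC_prod_eq_self hη₂ (hη₁.commutator_hodgeGroupC_eq_self_of_forall_rosati_eq hG₁ htriv₁).1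
    (hη₂.commutator_hodgeGroupC_eq_self_of_forall_rosati_eq hG₂ htriv₂).1

/-- **`End_ℚ(X₁) = ℚ` and `End_ℚ(X₂) = ℚ` ⟹ `Hg(X₁ × X₂)(ℂ)` perfect** (polarised, `X₁, X₂ ≠ 0`).
[cite: Gordon1997, §2.7 Proposition and §2.5.2 Corollary] [cite: MoonenZarhin1999LowDim, §1] -/
theorem IsRiemannForm.commutator_hodgeGroupC_prod_eq_self_of_endAlgRat_eq_bot [Nonempty ι₁] [Nonempty ι₂]
    (hη₁ : IsRiemannForm Φ₁ η₁) (hη₂ : IsRiemannForm Φ₂ η₂) (hE₁ : endAlgRat Φ₁ = ⊥) (hE₂ : endAlgRat Φ₂ = ⊥) :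
    ⁅hodgeGroupC (prodPeriod Φ₁ Φ₂), hodgeGroupC (prodPeriod Φ₁ Φ₂)⁆ = hodgeGroupC (prodPeriod Φ₁ Φ₂) :=
  hη₁.commutator_hodgeGroupC_prod_eq_self hη₂ (hη₁.commutator_hodgeGroupC_eq_self_of_endAlgRat_eq_bot hE₁).1
    (hη₂.commutator_hodgeGroupC_eq_self_of_endAlgRat_eq_bot hE₂).1

end Polarised

/-! ## §3 Three factors: `Hg((X₁ × X₂) × Y) = Hg(X₁ × X₂) × Hg(Y)` for perfect `Hg(Xᵢ)` and commutative `Hg(Y)` -/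

section Three

variable {Φ₁ Φ₂} {η₁ : E₁ [⋀^Fin 2]→L[ℝ] ℝ} {η₂ : E₂ [⋀^Fin 2]→L[ℝ] ℝ}
  {ι₃ : Type*} [Fintype ι₃] [DecidableEq ι₃] {E₃ : Type*} [NormedAddCommGroup E₃] [NormedSpace ℂ E₃]
  (Ψ : (ι₃ → ℝ) ≃L[ℝ] E₃)

/-- **`Hg((X₁ × X₂) × Y)(ℂ) = Hg(X₁ × X₂)(ℂ) × Hg(Y)(ℂ)`** for polarised `X₁`, `X₂` with perfect `Hg(Xᵢ)(ℂ)` and any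
torus `Y` with commutative `Hg(Y)(ℂ)` (Gordon's lemma, g37-#2, applied to the perfect group `Hg(X₁ × X₂)(ℂ)` of §2).
[cite: Gordon1997, §3 Theorem, proof (p0014 L33–L37)] [cite: MoonenZarhin1999LowDim, §3 Theorem (2)] -/
theorem IsRiemannForm.hodgeGroupC_prod_prod_eq_blockDiagProd_of_commutator_eq (hη₁ : IsRiemannForm Φ₁ η₁)
    (hη₂ : IsRiemannForm Φ₂ η₂) (h₁ : ⁅hodgeGroupC Φ₁, hodgeGroupC Φ₁⁆ = hodgeGroupC Φ₁)
    (h₂ : ⁅hodgeGroupC Φ₂, hodgeGroupC Φ₂⁆ = hodgeGroupC Φ₂) (hY : ⁅hodgeGroupC Ψ, hodgeGroupC Ψ⁆ = ⊥) :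
    hodgeGroupC (prodPeriod (prodPeriod Φ₁ Φ₂) Ψ) =
      blockDiagProd (hodgeGroupC (prodPeriod Φ₁ Φ₂)) (hodgeGroupC Ψ) :=
  hodgeGroupC_prod_eq_blockDiagProd_of_commutator_eq (prodPeriod Φ₁ Φ₂) Ψ
    (hη₁.commutator_hodgeGroupC_prod_eq_self hη₂ h₁ h₂) hY

/-- Real points: `Hg((X₁ × X₂) × Y)(ℝ) = Hg(X₁ × X₂)(ℝ) × Hg(Y)(ℝ)`. [cite: Gordon1997, §3 Theorem, proof (p0014 L33–L37)]
[cite: MoonenZarhin1999LowDim, §3 Theorem (2)] -/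
theorem IsRiemannForm.hodgeGroup_prod_prod_eq_of_commutator_eq (hη₁ : IsRiemannForm Φ₁ η₁)
    (hη₂ : IsRiemannForm Φ₂ η₂) (h₁ : ⁅hodgeGroupC Φ₁, hodgeGroupC Φ₁⁆ = hodgeGroupC Φ₁)
    (h₂ : ⁅hodgeGroupC Φ₂, hodgeGroupC Φ₂⁆ = hodgeGroupC Φ₂) (hY : ⁅hodgeGroupC Ψ, hodgeGroupC Ψ⁆ = ⊥) :
    hodgeGroup (prodPeriod (prodPeriod Φ₁ Φ₂) Ψ) =
      ((hodgeGroup (prodPeriod Φ₁ Φ₂)).prod (hodgeGroup Ψ)).map (blockDiag (ι₁ ⊕ ι₂) ι₃) :=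
  hodgeGroup_prod_eq_of_commutator_eq (prodPeriod Φ₁ Φ₂) Ψ (hη₁.commutator_hodgeGroupC_prod_eq_self hη₂ h₁ h₂) hY

/-- **`X₁ × X₂` stably nondegenerate (polarised `X₁`, `X₂` with perfect Hodge groups) and `Y` stably nondegenerate
with commutative `Hg(Y)(ℂ)` ⟹ `(X₁ × X₂) × Y` stably nondegenerate** (Hazama's product theorem, g37-#4, with the
first factor itself a product). [cite: Gordon1997, Thm. 7.6.2 and p0021 L22–L25] [cite: MoonenZarhin1999LowDim, §3 Theorem (2) and §1] -/
theorem IsRiemannForm.forall_divisorClasses_powPeriod_prod_prod_eq_hodgeClasses_of_commutator_eq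
    (hη₁ : IsRiemannForm Φ₁ η₁) (hη₂ : IsRiemannForm Φ₂ η₂) (h₁ : ⁅hodgeGroupC Φ₁, hodgeGroupC Φ₁⁆ = hodgeGroupC Φ₁)
    (h₂ : ⁅hodgeGroupC Φ₂, hodgeGroupC Φ₂⁆ = hodgeGroupC Φ₂) (hY : ⁅hodgeGroupC Ψ, hodgeGroupC Ψ⁆ = ⊥)
    (hX : ∀ k p, divisorClasses (powPeriod (prodPeriod Φ₁ Φ₂) k) p = hodgeClasses (powPeriod (prodPeriod Φ₁ Φ₂) k) p)
    (hYs : ∀ k p, divisorClasses (powPeriod Ψ k) p = hodgeClasses (powPeriod Ψ k) p) :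
    ∀ k p, divisorClasses (powPeriod (prodPeriod (prodPeriod Φ₁ Φ₂) Ψ) k) p =
      hodgeClasses (powPeriod (prodPeriod (prodPeriod Φ₁ Φ₂) Ψ) k) p :=
  forall_divisorClasses_powPeriod_prod_eq_hodgeClasses_of_commutator_eq
    (hη₁.commutator_hodgeGroupC_prod_eq_self hη₂ h₁ h₂) hY hX hYs

end Three

end ComplexTorus

end Literature.Geometry.Kaehler

end
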